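import Literature.NumberTheory.Automorphic.GLnUnipotentRadicalUnimodular
import HarnessLib

/-!
# Subgroups between the unipotent radical and the parabolic: `H = (H ∩ M_c) ⋉ U_c` topologically,
# and the Haar measure of `H` in the coordinates `h = v u`

Topic `NumberTheory/Automorphic`; namespace `Literature.NumberTheory.Automorphic`. KERNEL
mathematics only: theorems, no definition, no named fact, no instance, no `sorry`. For a block
labelling `c` and a subgroup `H` of `GL_n` with `U_c ≤ H ≤ P_c` (e.g. `H` the full upper unitriangular
group `N = U_{id}` inside a two-block parabolic `P_c = M_c U_c`, so that `H ∩ M_c` is the unipotent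
radical of the Levi factor: the step `N = N_M ⋉ U` of the descent of orbital integrals to a split
torus, Rogawski 1990, §4.13), the Levi decomposition `p = ℓ(p) · (ℓ(p)⁻¹ p)` of `P_c`
(`leviUnipotentHomeomorph`, Bernstein–Zelevinsky 1977, §2.1) restricts to `H`:

* `levi_part_mem_of_mem` — for `h ∈ H` the block-diagonal part `ℓ(h)` lies in `H ∩ M_c`;
* `exists_homeomorph_inf_levi_prod_unipotentRadical` — **`(v, u) ↦ v u` is a homeomorphism
  `(H ∩ M_c) × U_c ≃ₜ H`** (any topological commutative ring);
* `exists_haar_eq_smul_map_mul` — over a non-archimedean local field `F`: **every Haar measure on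
  `H` is `κ₀ • ((v, u) ↦ v u)_* (α ⊗ μ_U)`**, `κ₀ ≠ 0`, for any Haar measures `α` on `H ∩ M_c` and
  `μ_U` on `U_c` (`KNAQuotientIntegration.isHaarMeasure_map_anMap`: the skew product of left
  translations; Folland 1995, §2.6); `lintegral_haar_eq_mul_lintegral_lintegral` — hence
  **`∫⁻_H G(h) dμ_H = κ₀ ∫⁻_{H ∩ M_c} ∫⁻_{U_c} G(v u) dμ_U dα`** for every Borel `G ≥ 0` on `GL_n(F)`.

## References

* [BernsteinZelevinsky1977] I. N. Bernstein, A. V. Zelevinsky, Ann. Sci. ÉNS 10 (1977), §2.1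
  (`P = M ⋉ U`).
* [Folland1995] G. B. Folland, *A Course in Abstract Harmonic Analysis* (1995), §2.6.
* [Rogawski1990] J. D. Rogawski, *Automorphic Representations of Unitary Groups in Three Variables*
  (1990), §4.13.
-/

noncomputable section

open scoped MatrixGroups NNReal ENNReal
open MeasureTheory Measure Matrix Topology

namespace Literature.NumberTheory.Automorphic

open Literature.NumberTheory.GaloisRepresentations.IsNonarchimedeanLocalField

/-! ### 1. The Levi part of an element of `H`, `U_c ≤ H ≤ P_c` -/

section Algebra

variable {R : Type*} [CommRing R] {n : Type*} [Fintype n] [DecidableEq n] {α : Type*}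
  [LinearOrder α] [Fintype α] {c : n → α} {H : Subgroup (GL n R)}

/-- For `U_c ≤ H ≤ P_c` and `h ∈ H`, **the block-diagonal part `ℓ(h)` of `h` lies in `H ∩ M_c`**
(`ℓ(h) = h · (ℓ(h)⁻¹ h)⁻¹` with `ℓ(h)⁻¹ h ∈ U_c ≤ H`, `leviEmbeddingP_inv_mul_mem_unipotentRadicalP`).
[cite: BernsteinZelevinsky1977, §2.1] -/
theorem levi_part_mem_of_mem (hUH : unipotentRadicalGL R c ≤ H) (hHP : H ≤ standardParabolicGL R c)
    {h : GL n R} (hh : h ∈ H) :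
    (leviEmbeddingP R c (leviProjection R c ⟨h, hHP hh⟩) : GL n R) ∈ H ⊓ standardLeviGL R c := by
  refine ⟨?_, ⟨leviProjection R c ⟨h, hHP hh⟩, rfl⟩⟩
  have hu : ((leviEmbeddingP R c (leviProjection R c ⟨h, hHP hh⟩))⁻¹ * ⟨h, hHP hh⟩ :
      standardParabolicGL R c) ∈ unipotentRadicalP R c :=
    leviEmbeddingP_inv_mul_mem_unipotentRadicalP ⟨h, hHP hh⟩
  have hu' : (((leviEmbeddingP R c (leviProjection R c ⟨h, hHP hh⟩))⁻¹ * ⟨h, hHP hh⟩ :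
      standardParabolicGL R c) : GL n R) ∈ unipotentRadicalGL R c := by
    rw [← unipotentRadicalGL_subgroupOf, Subgroup.mem_subgroupOf] at hu
    exact hu
  have hkey : (leviEmbeddingP R c (leviProjection R c ⟨h, hHP hh⟩) : GL n R) =
      h * ((((leviEmbeddingP R c (leviProjection R c ⟨h, hHP hh⟩))⁻¹ * ⟨h, hHP hh⟩ :
        standardParabolicGL R c) : GL n R))⁻¹ := by
    rw [Subgroup.coe_mul, Subgroup.coe_inv, _root_.mul_inv_rev, inv_inv]
    exact (mul_inv_cancel_left _ _).symm
  rw [hkey]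
  exact H.mul_mem hh (H.inv_mem (hUH hu'))

variable [TopologicalSpace R] [IsTopologicalRing R]

/-- **`(v, u) ↦ v u` is a homeomorphism `(H ∩ M_c) × U_c ≃ₜ H`** for `U_c ≤ H ≤ P_c`, with inverse
`h ↦ (ℓ(h), ℓ(h)⁻¹ h)` (the restriction of `leviUnipotentHomeomorph`: `P_c = M_c ⋉ U_c`).
Existence form (no definition). [cite: BernsteinZelevinsky1977, §2.1] -/
theorem exists_homeomorph_inf_levi_prod_unipotentRadical (hUH : unipotentRadicalGL R c ≤ H)
    (hHP : H ≤ standardParabolicGL R c) :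
    ∃ e : ↥(H ⊓ standardLeviGL R c) × ↥(unipotentRadicalGL R c) ≃ₜ ↥H,
      ∀ q, ((e q : H) : GL n R) = (q.1 : GL n R) * (q.2 : GL n R) := by
  -- the Levi part `ℓ` and the unipotent part, as continuous maps on `H`
  let ℓ : H → GL n R := fun h => (leviEmbeddingP R c (leviProjection R c ⟨h.1, hHP h.2⟩) : GL n R)
  have hℓc : Continuous ℓ :=
    continuous_subtype_val.comp (((continuous_leviEmbeddingP R c).comp
      (continuous_leviProjection R c)).comp (continuous_subtype_val.subtype_mk _))
  have hℓmem : ∀ h : H, ℓ h ∈ H ⊓ standardLeviGL R c :=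
    fun h => levi_part_mem_of_mem hUH hHP h.2
  have humem : ∀ h : H, (ℓ h)⁻¹ * (h : GL n R) ∈ unipotentRadicalGL R c := by
    intro h
    have hu := leviEmbeddingP_inv_mul_mem_unipotentRadicalP (R := R) (c := c) ⟨h.1, hHP h.2⟩
    rw [← unipotentRadicalGL_subgroupOf, Subgroup.mem_subgroupOf] at hu
    exact hu
  refine ⟨{ toFun := fun q => ⟨(q.1 : GL n R) * (q.2 : GL n R),
              H.mul_mem q.1.2.1 (hUH q.2.2)⟩
            invFun := fun h => (⟨ℓ h, hℓmem h⟩, ⟨(ℓ h)⁻¹ * (h : GL n R), humem h⟩)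
            left_inv := fun q => ?_
            right_inv := fun h => Subtype.ext (mul_inv_cancel_left _ _)
            continuous_toFun := ((continuous_subtype_val.comp continuous_fst).mul
              (continuous_subtype_val.comp continuous_snd)).subtype_mk _
            continuous_invFun := (hℓc.subtype_mk _).prodMk
              ((hℓc.inv.mul continuous_subtype_val).subtype_mk _) }, fun q => rfl⟩
  -- left inverse: `ℓ(v u) = v` for `v ∈ M_c`, `u ∈ U_c`
  obtain ⟨⟨v, hvH, m, hm⟩, ⟨u, hu⟩⟩ := q
  have huP : (⟨u, unipotentRadicalGL_le R c hu⟩ : standardParabolicGL R c) ∈ unipotentRadicalP R c := by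
    rw [← unipotentRadicalGL_subgroupOf, Subgroup.mem_subgroupOf]; exact hu
  have hvP : v ∈ standardParabolicGL R c := hm ▸ (leviEmbeddingP R c m).2
  have hℓvu : ℓ ⟨v * u, H.mul_mem hvH (hUH hu)⟩ = v := by
    change (leviEmbeddingP R c (leviProjection R c ⟨v * u, _⟩) : GL n R) = v
    have hsplit : (⟨v * u, hHP (H.mul_mem hvH (hUH hu))⟩ : standardParabolicGL R c) =
        ⟨v, hvP⟩ * ⟨u, unipotentRadicalGL_le R c hu⟩ := rfl
    rw [hsplit, map_mul, (MonoidHom.mem_ker).1 huP, mul_one]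
    have hvm : (⟨v, hvP⟩ : standardParabolicGL R c) = leviEmbeddingP R c m := Subtype.ext hm.symm
    rw [hvm, leviProjection_leviEmbeddingP_apply]
    exact hm
  refine Prod.ext (Subtype.ext hℓvu) (Subtype.ext ?_)
  change (ℓ ⟨v * u, _⟩)⁻¹ * (v * u) = u
  rw [hℓvu, inv_mul_cancel_left]

end Algebra

/-! ### 2. The Haar measure of `H` in the coordinates `h = v u` -/

section Haar

variable (F : Type*) [Field F] [ValuativeRel F] [TopologicalSpace F] [IsNonarchimedeanLocalField F]
  {n : ℕ} {α : Type*} [LinearOrder α] [Fintype α] {c : Fin n → α}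
  [MeasurableSpace (GL (Fin n) F)] [BorelSpace (GL (Fin n) F)] {H : Subgroup (GL (Fin n) F)}

/-- **The Haar measure of `H` (`U_c ≤ H ≤ P_c`, `H` closed) in the coordinates `h = v u`**: for
Haar measures `μ_H` on `H`, `α` on `H ∩ M_c` and `μ_U` on `U_c` there are a homeomorphism
`e : (H ∩ M_c) × U_c ≃ₜ H`, `e(v, u) = v u`, and `κ₀ ∈ (0, ∞)` with `μ_H = κ₀ • e_* (α ⊗ μ_U)`
(`e_* (α ⊗ μ_U)` is a left Haar measure: `KNAQuotientIntegration.isHaarMeasure_map_anMap`, the skew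
product of left translations; uniqueness of Haar measure). (Folland 1995, §2.6; Bernstein–Zelevinsky
1977, §2.1.) [cite: Folland1995, §2.6] -/
theorem exists_haar_eq_smul_map_mul (hH : IsClosed (H : Set (GL (Fin n) F)))
    (hUH : unipotentRadicalGL F c ≤ H) (hHP : H ≤ standardParabolicGL F c)
    (μH : Measure ↥H) [IsHaarMeasure μH]
    (αM : Measure ↥(H ⊓ standardLeviGL F c)) [IsHaarMeasure αM]
    (μU : Measure ↥(unipotentRadicalGL F c)) [IsHaarMeasure μU] :
    ∃ (e : ↥(H ⊓ standardLeviGL F c) × ↥(unipotentRadicalGL F c) ≃ₜ ↥H) (κ₀ : ℝ≥0∞),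
      κ₀ ≠ 0 ∧ κ₀ ≠ ∞ ∧
      (∀ q, ((e q : H) : GL (Fin n) F) = (q.1 : GL (Fin n) F) * (q.2 : GL (Fin n) F)) ∧
      μH = κ₀ • Measure.map e (αM.prod μU) := by
  haveI : T2Space F := (isLocalField F).toT2Space
  haveI : SecondCountableTopology F := secondCountableTopology_localField F
  haveI : LocallyCompactSpace F := (isLocalField F).toLocallyCompactSpace
  haveI : SecondCountableTopology (Matrix (Fin n) (Fin n) F) :=
    inferInstanceAs (SecondCountableTopology (Fin n → Fin n → F))
  haveI : SecondCountableTopology (Matrix (Fin n) (Fin n) F)ᵐᵒᵖ :=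
    MulOpposite.opHomeomorph.symm.secondCountableTopology
  haveI : SecondCountableTopology (GL (Fin n) F) :=
    Units.isEmbedding_embedProduct.secondCountableTopology
  haveI : LocallyCompactSpace (Matrix (Fin n) (Fin n) F) :=
    inferInstanceAs (LocallyCompactSpace (Fin n → Fin n → F))
  haveI : LocallyCompactSpace (GL (Fin n) F) := inferInstance
  haveI : IsTopologicalRing F := inferInstance
  haveI : SecondCountableTopology ↥(H ⊓ standardLeviGL F c) :=
    TopologicalSpace.Subtype.secondCountableTopology _
  haveI : SecondCountableTopology ↥(unipotentRadicalGL F c) :=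
    TopologicalSpace.Subtype.secondCountableTopology _
  haveI : SecondCountableTopology ↥H := TopologicalSpace.Subtype.secondCountableTopology _
  haveI : BorelSpace ↥(H ⊓ standardLeviGL F c) := Subtype.borelSpace _
  haveI : BorelSpace ↥(unipotentRadicalGL F c) := Subtype.borelSpace _
  haveI : BorelSpace ↥H := Subtype.borelSpace _
  haveI : BorelSpace (↥(H ⊓ standardLeviGL F c) × ↥(unipotentRadicalGL F c)) := Prod.borelSpace
  haveI : LocallyCompactSpace ↥H := hH.locallyCompactSpace
  have hHM : IsClosed ((H ⊓ standardLeviGL F c : Subgroup (GL (Fin n) F)) : Set (GL (Fin n) F)) := by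
    rw [Subgroup.coe_inf]; exact hH.inter (isClosed_standardLeviGL (R := F) c)
  haveI : LocallyCompactSpace ↥(H ⊓ standardLeviGL F c) := hHM.locallyCompactSpace
  haveI : LocallyCompactSpace ↥(unipotentRadicalGL F c) :=
    (isClosed_unipotentRadicalGL c).locallyCompactSpace
  haveI : SFinite αM := inferInstance
  haveI : SFinite μU := inferInstance
  obtain ⟨e, he⟩ := exists_homeomorph_inf_levi_prod_unipotentRadical (R := F) hUH hHP
  have hAN : ∀ a ∈ H ⊓ standardLeviGL F c, ∀ u ∈ unipotentRadicalGL F c,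
      a * u * a⁻¹ ∈ unipotentRadicalGL F c :=
    fun a ha u hu => conj_mem_unipotentRadicalGL_of_mem_standardLeviGL c ha.2 hu
  have he' : ∀ q, e q = anMap (H ⊓ standardLeviGL F c) (unipotentRadicalGL F c) H inf_le_left hUH q :=
    fun q => Subtype.ext (he q)
  haveI := isHaarMeasure_map_anMap H inf_le_left hUH hAN αM μU e he'
  have hcoe : (anMap (H ⊓ standardLeviGL F c) (unipotentRadicalGL F c) H inf_le_left hUH :
      _ → ↥H) = e := funext fun q => (he' q).symm
  set ν₀ : Measure ↥H := Measure.map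
    (anMap (H ⊓ standardLeviGL F c) (unipotentRadicalGL F c) H inf_le_left hUH) (αM.prod μU) with hν₀
  obtain ⟨K₀⟩ : Nonempty (TopologicalSpace.PositiveCompacts ↥H) := inferInstance
  have h0 : ν₀ K₀ ≠ 0 := (Measure.measure_pos_of_nonempty_interior ν₀ K₀.interior_nonempty).ne'
  have htop : ν₀ K₀ ≠ ⊤ := K₀.isCompact.measure_lt_top.ne
  have hμ0 : μH K₀ ≠ 0 := (Measure.measure_pos_of_nonempty_interior μH K₀.interior_nonempty).ne'
  have hμtop : μH K₀ ≠ ⊤ := K₀.isCompact.measure_lt_top.ne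
  refine ⟨e, μH K₀ / ν₀ K₀, (ENNReal.div_pos_iff.2 ⟨hμ0, htop⟩).ne', (ENNReal.div_lt_top hμtop h0).ne,
    he, ?_⟩
  rw [← hcoe]
  exact measure_eq_div_smul μH ν₀ h0 htop

/-- **Integration over `H` in the coordinates `h = v u`**: with one constant `κ₀ ∈ (0, ∞)`,
`∫⁻_H G(h) dμ_H = κ₀ ∫⁻_{H ∩ M_c} ∫⁻_{U_c} G(v u) dμ_U dα` for every Borel `G : GL_n(F) → [0, ∞]`
(`exists_haar_eq_smul_map_mul`, transport along the homeomorphism, Tonelli). [cite: Folland1995, §2.6] -/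
theorem exists_lintegral_haar_eq_mul_lintegral_lintegral (hH : IsClosed (H : Set (GL (Fin n) F)))
    (hUH : unipotentRadicalGL F c ≤ H) (hHP : H ≤ standardParabolicGL F c)
    (μH : Measure ↥H) [IsHaarMeasure μH]
    (αM : Measure ↥(H ⊓ standardLeviGL F c)) [IsHaarMeasure αM]
    (μU : Measure ↥(unipotentRadicalGL F c)) [IsHaarMeasure μU] :
    ∃ κ₀ : ℝ≥0∞, κ₀ ≠ 0 ∧ κ₀ ≠ ∞ ∧ ∀ G : GL (Fin n) F → ℝ≥0∞, Measurable G →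
      ∫⁻ h, G (h : GL (Fin n) F) ∂μH =
        κ₀ * ∫⁻ v, ∫⁻ u, G ((v : GL (Fin n) F) * (u : GL (Fin n) F)) ∂μU ∂αM := by
  haveI : T2Space F := (isLocalField F).toT2Space
  haveI : SecondCountableTopology F := secondCountableTopology_localField F
  haveI : LocallyCompactSpace F := (isLocalField F).toLocallyCompactSpace
  haveI : SecondCountableTopology (Matrix (Fin n) (Fin n) F) :=
    inferInstanceAs (SecondCountableTopology (Fin n → Fin n → F))
  haveI : SecondCountableTopology (Matrix (Fin n) (Fin n) F)ᵐᵒᵖ :=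
    MulOpposite.opHomeomorph.symm.secondCountableTopology
  haveI : SecondCountableTopology (GL (Fin n) F) :=
    Units.isEmbedding_embedProduct.secondCountableTopology
  haveI : LocallyCompactSpace (Matrix (Fin n) (Fin n) F) :=
    inferInstanceAs (LocallyCompactSpace (Fin n → Fin n → F))
  haveI : SecondCountableTopology ↥(H ⊓ standardLeviGL F c) :=
    TopologicalSpace.Subtype.secondCountableTopology _
  haveI : SecondCountableTopology ↥(unipotentRadicalGL F c) :=
    TopologicalSpace.Subtype.secondCountableTopology _
  haveI : SecondCountableTopology ↥H := TopologicalSpace.Subtype.secondCountableTopology _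
  haveI : BorelSpace ↥(H ⊓ standardLeviGL F c) := Subtype.borelSpace _
  haveI : BorelSpace ↥(unipotentRadicalGL F c) := Subtype.borelSpace _
  haveI : BorelSpace ↥H := Subtype.borelSpace _
  haveI : BorelSpace (↥(H ⊓ standardLeviGL F c) × ↥(unipotentRadicalGL F c)) := Prod.borelSpace
  haveI : LocallyCompactSpace ↥(unipotentRadicalGL F c) :=
    (isClosed_unipotentRadicalGL c).locallyCompactSpace
  haveI : SFinite μU := inferInstance
  obtain ⟨e, κ₀, hκ0, hκt, he, hμ⟩ := exists_haar_eq_smul_map_mul F hH hUH hHP μH αM μU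
  refine ⟨κ₀, hκ0, hκt, fun G hG => ?_⟩
  have hm : Measurable fun q : ↥(H ⊓ standardLeviGL F c) × ↥(unipotentRadicalGL F c) =>
      G ((q.1 : GL (Fin n) F) * (q.2 : GL (Fin n) F)) :=
    hG.comp ((continuous_subtype_val.comp continuous_fst).mul
      (continuous_subtype_val.comp continuous_snd)).measurable
  rw [hμ, lintegral_smul_measure, smul_eq_mul, ← Homeomorph.toMeasurableEquiv_coe,
    lintegral_map_equiv, ← lintegral_prod _ hm.aemeasurable]
  congr 1
  refine lintegral_congr fun q => ?_
  rw [Homeomorph.toMeasurableEquiv_coe, he]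

end Haar

end Literature.NumberTheory.Automorphic
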